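import Summits.HubbardSuperconductivity.HubbardSuperconductivity.Theorems.ChiralWindowCwKLChiralWindowReductionL2
import HarnessLib

/-!
# Crux `CwThesis` (stmt-HubbardSuperconductivity-10438), line `SketchIdeator3`, stub `stub_a1gReduction`:
the `s`-wave channel competes only through its mean-zero (extended-`s`) states

Write `ε = squareDispersion 1 0`, `-4 < μ < 0`, `σ = fermiCurveMeasure ε μ` (a finite measure of total mass
`m₀ > 0`), `Γ_U(k,k') = U + U² χ₀(k+k')` and `⟨ψ, Γ_U ψ⟩ = pairingForm ε μ U ψ`.  For an `A1g` channel state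
`ψ` put `a = ∫ ψ dσ`, `c = a/m₀` and `ψ⊥ = ψ - c` (again `A1g`, mean zero, `∫ ψ⊥² dσ = 1 - a²/m₀`).  Then

* `⟨ψ, Γ_U ψ⟩ = U² ⟨ψ, Γ_1 ψ⟩ + (U - U²) a²` (tree: `kl_rl_pairingForm_sub`);
* `⟨ψ⊥, Γ_1 ψ⊥⟩ ≥ λ ∫ψ⊥² dσ` as soon as `λ ≤ ⟨φ, Γ_1 φ⟩` for all mean-zero `A1g` channel states `φ`
  (normalise `ψ⊥`; if `∫ψ⊥² dσ = 0` the form vanishes by the Hilbert–Schmidt bound)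
  (`pairingForm_one_ge_of_meanZero`);
* `⟨ψ, Γ_1 ψ⟩ ≥ ⟨ψ⊥, Γ_1 ψ⊥⟩ - 2 B₀ |c| - G₀ c²` with constants of the band level only: in the polar
  picture the form is `∫ M_1 · (Ψ ⊗ Ψ) dθ dθ'` with `M_1 ∈ L²(dθ dθ')` (`kl_rl_memLp_kernelPolar`), and
  `Ψ ⊗ Ψ = Ψ⊥ ⊗ Ψ⊥ + Ψ⊥ ⊗ c + c ⊗ Ψ⊥ + c ⊗ c` is controlled term by term by Cauchy–Schwarz
  (`pairingForm_one_sub_const_estimate`).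

Hence `⟨ψ, Γ_U ψ⟩ ≥ U² λ + (U a² - U² A a² - 2 U² B |a|) ≥ U² λ - C U³` for `0 < U < 1` (`cubic_cost`): the bare
repulsion `U a²` pays for the constant harmonic at a cost `O(U³)` (`stub_a1gReduction`).  No definitions.

References: S. Raghu, S. A. Kivelson, D. J. Scalapino, Phys. Rev. B 81 (2010) 224505, §III.
-/

noncomputable section

set_option linter.dupNamespace false

namespace Summit.HubbardSuperconductivity.HubbardSuperconductivity.Theorems.CwThesis

open MeasureTheory Real Set Filter Literature.MathematicalPhysics.QuantumLattice
open Summit.HubbardSuperconductivity.HubbardSuperconductivity.Theses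

/-! ### Cauchy–Schwarz against a Hilbert–Schmidt kernel, for a tensor of two `L²` functions -/

section Tensor

variable {α : Type*} [MeasurableSpace α] {ν : Measure α}

/-- `F ⊗ G ∈ L²(ν ⊗ ν)` for `F, G ∈ L²(ν)`. [folklore] -/
theorem memLp_two_tensor₂ {F G : α → ℝ} (hF : MemLp F 2 ν) (hG : MemLp G 2 ν) :
    MemLp (fun z : α × α => F z.1 * G z.2) 2 (ν.prod ν) := by
  have hmeas : AEStronglyMeasurable (fun z : α × α => F z.1 * G z.2) (ν.prod ν) :=
    hF.1.comp_fst.mul hG.1.comp_snd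
  rw [memLp_two_iff_integrable_sq hmeas]
  have hF2 : Integrable (fun x => F x ^ 2) ν := (memLp_two_iff_integrable_sq hF.1).1 hF
  have hG2 : Integrable (fun x => G x ^ 2) ν := (memLp_two_iff_integrable_sq hG.1).1 hG
  refine (hF2.mul_prod hG2).congr (Eventually.of_forall fun z => ?_)
  simp only
  ring

/-- `∫ (F ⊗ G)² d(ν ⊗ ν) = (∫ F² dν) (∫ G² dν)`. [folklore] -/
theorem integral_tensor₂_sq [SFinite ν] (F G : α → ℝ) :
    ∫ z, (F z.1 * G z.2) ^ 2 ∂(ν.prod ν) = (∫ x, F x ^ 2 ∂ν) * ∫ x, G x ^ 2 ∂ν := by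
  rw [← integral_prod_mul (μ := ν) (ν := ν) (fun x => F x ^ 2) (fun y => G y ^ 2)]
  refine integral_congr_ae (Eventually.of_forall fun z => ?_)
  simp only
  ring

/-- **Cauchy–Schwarz against a Hilbert–Schmidt kernel**: `|∫ M (F ⊗ G)| ≤ ‖M‖₂ ‖F‖₂ ‖G‖₂` for
`M ∈ L²(ν ⊗ ν)`, `F, G ∈ L²(ν)`. [folklore] -/
theorem abs_integral_mul_tensor₂_le [SFinite ν] {F G : α → ℝ} {M : α × α → ℝ} (hM : MemLp M 2 (ν.prod ν))
    (hF : MemLp F 2 ν) (hG : MemLp G 2 ν) :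
    |∫ z, M z * (F z.1 * G z.2) ∂(ν.prod ν)| ≤
      Real.sqrt (∫ z, M z ^ 2 ∂(ν.prod ν)) * (Real.sqrt (∫ x, F x ^ 2 ∂ν) * Real.sqrt (∫ x, G x ^ 2 ∂ν)) := by
  have h := abs_integral_mul_le_sqrt_mul_sqrt hM (memLp_two_tensor₂ hF hG)
  rwa [integral_tensor₂_sq, Real.sqrt_mul (integral_nonneg fun x => sq_nonneg _)] at h

end Tensor

/-! ### Linearity of the isotypic projection -/

/-- The isotypic projection is additive: `P_χ (f - g) = P_χ f - P_χ g`. [folklore] -/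
theorem d4Project_sub (χ : D4Irrep) (f g : Momentum → ℝ) :
    d4Project χ (fun k => f k - g k) = fun k => d4Project χ f k - d4Project χ g k := by
  funext k
  simp only [d4Project, mul_sub, Finset.sum_sub_distrib]

/-- Subtracting a constant from an `A1g` (= `s`-wave) function gives an `A1g` function.
[cite: RaghuKivelsonScalapino2010, §III (17)] -/
theorem inChannel_A1g_sub_const {ψ : Momentum → ℝ} (h : InChannel .A1g ψ) (c : ℝ) :
    InChannel .A1g (fun k => ψ k - c) := by
  have h1 : d4Project .A1g ψ = ψ := h
  have h2 : d4Project .A1g (fun _ : Momentum => c) = fun _ => c := inChannel_A1g_const c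
  show d4Project .A1g (fun k => ψ k - (fun _ : Momentum => c) k) = fun k => ψ k - c
  rw [d4Project_sub .A1g ψ (fun _ => c), h1, h2]

/-! ### The elementary `O(U³)` cost -/

/-- **The cubic cost of the constant harmonic.** For `A ≥ 1`, `t² ≤ m` and `U > 0`:
`U t² - U² A t² - 2 U² B t ≥ -(2B² + 2A(Am + B² + m)) U³` (if `2AU ≤ 1` complete the square in `t`,
otherwise `U² ≤ 2A U³`). [folklore] -/
theorem cubic_cost {A B m t U : ℝ} (hA : 1 ≤ A) (htm : t ^ 2 ≤ m) (hU : 0 < U) :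
    -((2 * B ^ 2 + 2 * A * (A * m + B ^ 2 + m)) * U ^ 3) ≤
      U * t ^ 2 - U ^ 2 * A * t ^ 2 - 2 * U ^ 2 * B * t := by
  have hA0 : 0 ≤ A := le_trans zero_le_one hA
  have hm : 0 ≤ m := le_trans (sq_nonneg t) htm
  have hS : 0 ≤ A * m + B ^ 2 + m := by positivity
  rcases le_or_gt (2 * A * U) 1 with h | h
  · have h1 : 0 ≤ U * t ^ 2 * (1 - 2 * A * U) := mul_nonneg (mul_nonneg hU.le (sq_nonneg t)) (by linarith)
    have h2 : 0 ≤ U * (t - 2 * U * B) ^ 2 := mul_nonneg hU.le (sq_nonneg _)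
    have h3 : 0 ≤ U ^ 3 * A * (A * m + B ^ 2 + m) := mul_nonneg (mul_nonneg (pow_nonneg hU.le 3) hA0) hS
    nlinarith [h1, h2, h3]
  · have h1 : 0 ≤ U * t ^ 2 := mul_nonneg hU.le (sq_nonneg t)
    have h2 : 0 ≤ U ^ 2 * A * (m - t ^ 2) := mul_nonneg (mul_nonneg (sq_nonneg U) hA0) (sub_nonneg.2 htm)
    have h3 : 0 ≤ U ^ 2 * (B - t) ^ 2 := mul_nonneg (sq_nonneg U) (sq_nonneg _)
    have h4 : 0 ≤ U ^ 2 * (m - t ^ 2) := mul_nonneg (sq_nonneg U) (sub_nonneg.2 htm)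
    have h5 : 0 ≤ U ^ 2 * (A * m + B ^ 2 + m) * (2 * A * U - 1) :=
      mul_nonneg (mul_nonneg (sq_nonneg U) hS) (by linarith)
    have h6 : 0 ≤ B ^ 2 * U ^ 3 := mul_nonneg (sq_nonneg B) (pow_nonneg hU.le 3)
    nlinarith [h1, h2, h3, h4, h5, h6]

/-! ### The frame at a band level `-4 < μ < 0` -/

section Band

variable {μ : ℝ} (hμ₁ : -4 < μ) (hμ₂ : μ < 0)
include hμ₁ hμ₂

/-- **Subtracting a constant from an `A1g` channel state.** For an `A1g` channel state `ψ` with mean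
`a = ∫ ψ dσ`, total mass `m₀ = σ(univ)` and any constant `c`, the function `ψ - c` is in `L²(σ)`, in `A1g`,
`∫ (ψ - c) dσ = a - c m₀` and `∫ (ψ - c)² dσ = 1 - 2 c a + c² m₀`. [folklore] -/
theorem a1g_sub_const {ψ : Momentum → ℝ} {a m₀ : ℝ}
    (hψ : IsChannelState (squareDispersion 1 0) μ D4Irrep.A1g ψ)
    (ha : ∫ k, ψ k ∂fermiCurveMeasure (squareDispersion 1 0) μ = a)
    (hm₀ : (fermiCurveMeasure (squareDispersion 1 0) μ).real univ = m₀) (c : ℝ) :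
    MemLp (fun k => ψ k - c) 2 (fermiCurveMeasure (squareDispersion 1 0) μ) ∧
    InChannel D4Irrep.A1g (fun k => ψ k - c) ∧
    ∫ k, (ψ k - c) ∂fermiCurveMeasure (squareDispersion 1 0) μ = a - c * m₀ ∧
    ∫ k, (ψ k - c) ^ 2 ∂fermiCurveMeasure (squareDispersion 1 0) μ = 1 - 2 * c * a + c ^ 2 * m₀ := by
  haveI := isFiniteMeasure_fermiCurveMeasure hμ₁ hμ₂
  obtain ⟨hmem, hnorm, hch⟩ := hψ
  have hI : Integrable ψ (fermiCurveMeasure (squareDispersion 1 0) μ) := hmem.integrable one_le_two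
  have hsqI : Integrable (fun k => ψ k ^ 2) (fermiCurveMeasure (squareDispersion 1 0) μ) :=
    (memLp_two_iff_integrable_sq hmem.1).1 hmem
  refine ⟨hmem.sub (memLp_const c), inChannel_A1g_sub_const hch c, ?_, ?_⟩
  · rw [integral_sub hI (integrable_const c), integral_const, ha, hm₀, smul_eq_mul, mul_comm]
  · have h1 : (fun k => (ψ k - c) ^ 2) = fun k => ψ k ^ 2 - 2 * c * ψ k + c ^ 2 := by
      funext k; ring
    have i1 : Integrable (fun k => ψ k ^ 2 - 2 * c * ψ k) (fermiCurveMeasure (squareDispersion 1 0) μ) :=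
      hsqI.sub (hI.const_mul _)
    have i2 : Integrable (fun _ : Momentum => c ^ 2) (fermiCurveMeasure (squareDispersion 1 0) μ) :=
      integrable_const _
    rw [h1, integral_add i1 i2, integral_sub hsqI (hI.const_mul _), integral_const_mul, integral_const,
      hnorm, ha, hm₀, smul_eq_mul]
    ring

/-- **The `U = 1` form on mean-zero `A1g` functions.** If `λ ≤ ⟨φ, Γ_1 φ⟩` for every mean-zero `A1g`
channel state `φ`, then `λ ∫ f² dσ ≤ ⟨f, Γ_1 f⟩` for every mean-zero `A1g` function `f ∈ L²(σ)`: normalise `f`;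
when `∫ f² dσ = 0` the profile `f ∘ γ` vanishes in `L²(dθ)` and so does the form, by the Hilbert–Schmidt bound.
[cite: RaghuKivelsonScalapino2010, §III] -/
theorem pairingForm_one_ge_of_meanZero {lam : ℝ}
    (hlam : ∀ φ : Momentum → ℝ, IsChannelState (squareDispersion 1 0) μ D4Irrep.A1g φ →
      ∫ k, φ k ∂fermiCurveMeasure (squareDispersion 1 0) μ = 0 → lam ≤ pairingForm (squareDispersion 1 0) μ 1 φ)
    {f : Momentum → ℝ} (hmem : MemLp f 2 (fermiCurveMeasure (squareDispersion 1 0) μ))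
    (hch : InChannel D4Irrep.A1g f) (h0 : ∫ k, f k ∂fermiCurveMeasure (squareDispersion 1 0) μ = 0) :
    lam * ∫ k, f k ^ 2 ∂fermiCurveMeasure (squareDispersion 1 0) μ ≤
      pairingForm (squareDispersion 1 0) μ 1 f := by
  set N := ∫ k, f k ^ 2 ∂fermiCurveMeasure (squareDispersion 1 0) μ with hN
  have hN0 : 0 ≤ N := integral_nonneg fun k => sq_nonneg _
  rcases hN0.eq_or_lt with hN0' | hNpos
  · -- `N = 0`: the form vanishes
    obtain ⟨w₀, w₁, hw₀, hw⟩ := exists_bounds_fermiPolarDOS hμ₁ hμ₂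
    obtain ⟨hΨ, hΨle⟩ := memLp_profile hμ₁ hμ₂ hmem hw₀ (fun θ => (hw θ).1)
    have hM := kl_rl_memLp_kernelPolar hμ₁ hμ₂ (1 : ℝ)
    have hb := abs_integral_mul_integral_mul_le hΨ hM
    have hΨ0 : ∫ θ in Set.Ioc (-π) π, f (fermiPolar μ θ) ^ 2 = 0 := by
      refine le_antisymm ?_ (integral_nonneg fun θ => sq_nonneg _)
      calc ∫ θ in Set.Ioc (-π) π, f (fermiPolar μ θ) ^ 2 ≤ w₀⁻¹ * N := hΨle
        _ = 0 := by rw [← hN0', mul_zero]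
    have key : |pairingForm (squareDispersion 1 0) μ 1 f| ≤ 0 := by
      rw [pairingForm_eq_polar hμ₁ hμ₂ 1 hmem.1]
      refine hb.trans ?_
      rw [hΨ0, zero_mul]
    rw [abs_nonpos_iff.1 key, ← hN0', mul_zero]
  · -- `N > 0`: normalise
    have hstate := isChannelState_normalize hmem hch hNpos
    have hmean : ∫ k, (Real.sqrt N)⁻¹ * f k ∂fermiCurveMeasure (squareDispersion 1 0) μ = 0 := by
      rw [integral_const_mul, h0, mul_zero]
    have h := hlam _ hstate hmean
    rw [pairingForm_const_mul, inv_pow, Real.sq_sqrt hNpos.le] at h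
    have := mul_le_mul_of_nonneg_right h hNpos.le
    rwa [mul_comm N⁻¹, inv_mul_cancel_right₀ hNpos.ne'] at this

/-- **Removing a constant from the `U = 1` form costs `O(|c|)`.** There are constants `B₀, G₀ ≥ 0` of the
band level such that for every `ψ ∈ L²(σ)` and every constant `c` with `∫ (ψ - c)² dσ ≤ 1`,
`⟨ψ - c, Γ_1 (ψ - c)⟩ - (2 B₀ |c| + G₀ c²) ≤ ⟨ψ, Γ_1 ψ⟩`.  In the polar picture both forms are product
integrals `∫ M_1 · (Φ ⊗ Φ) dθ dθ'` of the Hilbert–Schmidt kernel `M_1` (`Φ = ψ ∘ γ`, resp. `ψ ∘ γ - c`), and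
`Ψ ⊗ Ψ = Ψ⊥ ⊗ Ψ⊥ + Ψ⊥ ⊗ c + c ⊗ Ψ⊥ + c ⊗ c` is bounded term by term by Cauchy–Schwarz
(`B₀ = ‖M_1‖₂ (2π / w₀)^{1/2}`, `G₀ = 2π ‖M_1‖₂`, `w₀` a lower bound of the density of states).
[cite: RaghuKivelsonScalapino2010, §III] -/
theorem pairingForm_one_sub_const_estimate :
    ∃ B₀ G₀ : ℝ, 0 ≤ B₀ ∧ 0 ≤ G₀ ∧ ∀ (ψ : Momentum → ℝ) (c : ℝ),
      MemLp ψ 2 (fermiCurveMeasure (squareDispersion 1 0) μ) →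
      ∫ k, (ψ k - c) ^ 2 ∂fermiCurveMeasure (squareDispersion 1 0) μ ≤ 1 →
        pairingForm (squareDispersion 1 0) μ 1 (fun k => ψ k - c) - (2 * B₀ * |c| + G₀ * c ^ 2) ≤
          pairingForm (squareDispersion 1 0) μ 1 ψ := by
  obtain ⟨w₀, w₁, hw₀, hw⟩ := exists_bounds_fermiPolarDOS hμ₁ hμ₂
  haveI := isFiniteMeasure_fermiCurveMeasure hμ₁ hμ₂
  -- the parameter interval `(-π, π]` with Lebesgue measure
  set ν : Measure ℝ := volume.restrict (Set.Ioc (-π) π)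
  -- the weighted polar kernel `M_1 ∈ L²(dθ dθ')`, its norm `K`, and the length `V` of the parameter interval
  set M : ℝ × ℝ → ℝ := fun z => fermiPolarDOS μ (Prod.fst z) *
    kohnLuttingerKernel (squareDispersion 1 0) μ 1 (fermiPolar μ (Prod.fst z)) (fermiPolar μ (Prod.snd z)) *
    fermiPolarDOS μ (Prod.snd z)
  have hM : MemLp M 2 (ν.prod ν) := kl_rl_memLp_kernelPolar hμ₁ hμ₂ 1
  obtain ⟨K, hK⟩ : ∃ K, Real.sqrt (∫ z, M z ^ 2 ∂(ν.prod ν)) = K := ⟨_, rfl⟩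
  obtain ⟨V, hV⟩ : ∃ V, ν.real univ = V := ⟨_, rfl⟩
  have hK0 : 0 ≤ K := by rw [← hK]; exact Real.sqrt_nonneg _
  have hV0 : 0 ≤ V := by rw [← hV]; exact measureReal_nonneg
  refine ⟨K * Real.sqrt (w₀⁻¹) * Real.sqrt V, K * V, by positivity, by positivity, ?_⟩
  intro ψ c hmem hle
  have hmem' : MemLp (fun k => ψ k - c) 2 (fermiCurveMeasure (squareDispersion 1 0) μ) :=
    hmem.sub (memLp_const c)
  obtain ⟨hΨ, -⟩ := memLp_profile hμ₁ hμ₂ hmem hw₀ (fun θ => (hw θ).1)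
  obtain ⟨hΨp, hΨple⟩ := memLp_profile hμ₁ hμ₂ hmem' hw₀ (fun θ => (hw θ).1)
  have hC : MemLp (fun _ : ℝ => c) 2 ν := memLp_const c
  -- the two forms as product integrals
  have hp : pairingForm (squareDispersion 1 0) μ 1 ψ =
      ∫ z, M z * (ψ (fermiPolar μ z.1) * ψ (fermiPolar μ z.2)) ∂(ν.prod ν) := by
    rw [pairingForm_eq_polar hμ₁ hμ₂ 1 hmem.1]
    exact integral_mul_integral_mul_eq_integral_prod hΨ hM
  have hp' : pairingForm (squareDispersion 1 0) μ 1 (fun k => ψ k - c) =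
      ∫ z, M z * ((ψ (fermiPolar μ z.1) - c) * (ψ (fermiPolar μ z.2) - c)) ∂(ν.prod ν) := by
    rw [pairingForm_eq_polar hμ₁ hμ₂ 1 hmem'.1]
    exact integral_mul_integral_mul_eq_integral_prod hΨp hM
  -- the four pieces of `M_1 (Ψ ⊗ Ψ)`, `Ψ = Ψ⊥ + c`
  have I1 : Integrable (fun z : ℝ × ℝ => M z * ((ψ (fermiPolar μ z.1) - c) * (ψ (fermiPolar μ z.2) - c)))
      (ν.prod ν) := hM.integrable_mul (memLp_two_tensor₂ hΨp hΨp)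
  have I2 : Integrable (fun z : ℝ × ℝ => M z * ((ψ (fermiPolar μ z.1) - c) * c)) (ν.prod ν) :=
    hM.integrable_mul (memLp_two_tensor₂ hΨp hC)
  have I3 : Integrable (fun z : ℝ × ℝ => M z * (c * (ψ (fermiPolar μ z.2) - c))) (ν.prod ν) :=
    hM.integrable_mul (memLp_two_tensor₂ hC hΨp)
  have I4 : Integrable (fun z : ℝ × ℝ => M z * (c * c)) (ν.prod ν) :=
    hM.integrable_mul (memLp_two_tensor₂ hC hC)
  have I12 : Integrable (fun z : ℝ × ℝ => M z * ((ψ (fermiPolar μ z.1) - c) * (ψ (fermiPolar μ z.2) - c)) +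
      M z * ((ψ (fermiPolar μ z.1) - c) * c)) (ν.prod ν) := I1.add I2
  have I123 : Integrable (fun z : ℝ × ℝ => M z * ((ψ (fermiPolar μ z.1) - c) * (ψ (fermiPolar μ z.2) - c)) +
      M z * ((ψ (fermiPolar μ z.1) - c) * c) + M z * (c * (ψ (fermiPolar μ z.2) - c))) (ν.prod ν) :=
    I12.add I3
  have hexp : ∫ z, M z * (ψ (fermiPolar μ z.1) * ψ (fermiPolar μ z.2)) ∂(ν.prod ν) =
      ∫ z, M z * ((ψ (fermiPolar μ z.1) - c) * (ψ (fermiPolar μ z.2) - c)) ∂(ν.prod ν) +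
      ∫ z, M z * ((ψ (fermiPolar μ z.1) - c) * c) ∂(ν.prod ν) +
      ∫ z, M z * (c * (ψ (fermiPolar μ z.2) - c)) ∂(ν.prod ν) +
      ∫ z, M z * (c * c) ∂(ν.prod ν) := by
    rw [← integral_add I1 I2, ← integral_add I12 I3, ← integral_add I123 I4]
    refine integral_congr_ae (Eventually.of_forall fun z => ?_)
    ring
  -- Cauchy–Schwarz bounds of the three correction terms
  have hcc : Real.sqrt (∫ _ : ℝ, c ^ 2 ∂ν) = Real.sqrt V * |c| := by
    rw [integral_const, smul_eq_mul, hV, Real.sqrt_mul hV0, Real.sqrt_sq_eq_abs]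
  have hNθ : Real.sqrt (∫ θ, (ψ (fermiPolar μ θ) - c) ^ 2 ∂ν) ≤ Real.sqrt (w₀⁻¹) := by
    refine Real.sqrt_le_sqrt (hΨple.trans ?_)
    calc w₀⁻¹ * ∫ k, (ψ k - c) ^ 2 ∂fermiCurveMeasure (squareDispersion 1 0) μ ≤ w₀⁻¹ * 1 :=
          mul_le_mul_of_nonneg_left hle (inv_nonneg.2 hw₀.le)
      _ = w₀⁻¹ := mul_one _
  have hVc : 0 ≤ Real.sqrt V * |c| := by positivity
  have hb2 : |∫ z, M z * ((ψ (fermiPolar μ z.1) - c) * c) ∂(ν.prod ν)| ≤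
      K * Real.sqrt (w₀⁻¹) * Real.sqrt V * |c| := by
    have h := abs_integral_mul_tensor₂_le hM hΨp hC
    rw [hK, hcc] at h
    refine h.trans ?_
    have : K * (Real.sqrt (∫ θ, (ψ (fermiPolar μ θ) - c) ^ 2 ∂ν) * (Real.sqrt V * |c|)) ≤
        K * (Real.sqrt (w₀⁻¹) * (Real.sqrt V * |c|)) :=
      mul_le_mul_of_nonneg_left (mul_le_mul_of_nonneg_right hNθ hVc) hK0
    linarith [this]
  have hb3 : |∫ z, M z * (c * (ψ (fermiPolar μ z.2) - c)) ∂(ν.prod ν)| ≤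
      K * Real.sqrt (w₀⁻¹) * Real.sqrt V * |c| := by
    have h := abs_integral_mul_tensor₂_le hM hC hΨp
    rw [hK, hcc] at h
    refine h.trans ?_
    have : K * (Real.sqrt V * |c| * Real.sqrt (∫ θ, (ψ (fermiPolar μ θ) - c) ^ 2 ∂ν)) ≤
        K * (Real.sqrt V * |c| * Real.sqrt (w₀⁻¹)) :=
      mul_le_mul_of_nonneg_left (mul_le_mul_of_nonneg_left hNθ hVc) hK0
    linarith [this]
  have hb4 : |∫ z, M z * (c * c) ∂(ν.prod ν)| ≤ K * V * c ^ 2 := by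
    have h := abs_integral_mul_tensor₂_le hM hC hC
    rw [hK, hcc] at h
    have hsq : Real.sqrt V * |c| * (Real.sqrt V * |c|) = V * c ^ 2 := by
      rw [mul_mul_mul_comm, Real.mul_self_sqrt hV0, abs_mul_abs_self, ← pow_two]
    rw [hsq, ← mul_assoc] at h
    exact h
  -- assemble
  rw [hp, hp', hexp]
  linarith [hb2, hb3, hb4, neg_abs_le (∫ z, M z * ((ψ (fermiPolar μ z.1) - c) * c) ∂(ν.prod ν)),
    neg_abs_le (∫ z, M z * (c * (ψ (fermiPolar μ z.2) - c)) ∂(ν.prod ν)),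
    neg_abs_le (∫ z, M z * (c * c) ∂(ν.prod ν))]

end Band

/-! ### The stub -/

/-- **Stub `stub_a1gReduction`: the `s`-wave channel competes only through mean-zero (extended-`s`) states.**
Let `-4 < μ < 0` and suppose `λ ≤ ⟨φ, Γ_1 φ⟩` for every `A1g` channel state `φ` of mean zero (for such `φ`
the `U = 1` form is the pure second-order Lindhard form).  Then there is `C ≥ 0` with
`U² λ - C U³ ≤ ⟨ψ, Γ_U ψ⟩` for every `A1g` channel state `ψ` and every `0 < U < 1`: writing `a = ∫ ψ dσ`,
`ψ = a/m₀ + ψ⊥`, one has `⟨ψ, Γ_U ψ⟩ = U a² + U² (⟨ψ, Γ_1 ψ⟩ - a²)` (`kl_rl_pairingForm_sub`),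
`⟨ψ, Γ_1 ψ⟩ ≥ λ (1 - a²/m₀) - 2 B₀ |a|/m₀ - G₀ a²/m₀²` (`pairingForm_one_ge_of_meanZero`,
`pairingForm_one_sub_const_estimate`), and the bare repulsion `U a²` absorbs every `U² O(a² + |a|)` term up
to `-C U³` (`cubic_cost`). [cite: RaghuKivelsonScalapino2010, §III] -/
theorem stub_a1gReduction {μ lam : ℝ} (hμ : μ ∈ Set.Ioo (-4 : ℝ) 0)
    (hlam : ∀ φ : Momentum → ℝ, IsChannelState (squareDispersion 1 0) μ D4Irrep.A1g φ →
      ∫ k, φ k ∂fermiCurveMeasure (squareDispersion 1 0) μ = 0 → lam ≤ pairingForm (squareDispersion 1 0) μ 1 φ) :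
    ∃ C : ℝ, 0 ≤ C ∧ ∀ U ∈ Set.Ioo (0:ℝ) 1, ∀ ψ : Momentum → ℝ,
      IsChannelState (squareDispersion 1 0) μ D4Irrep.A1g ψ →
        U ^ 2 * lam - C * U ^ 3 ≤ pairingForm (squareDispersion 1 0) μ U ψ := by
  obtain ⟨hμ₁, hμ₂⟩ := hμ
  -- the total mass `m₀ > 0` of the Fermi curve and its inverse
  obtain ⟨m₀, hm₀⟩ : ∃ m₀, (fermiCurveMeasure (squareDispersion 1 0) μ).real univ = m₀ := ⟨_, rfl⟩
  have hm₀pos : 0 < m₀ := by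
    rw [← hm₀, measureReal_def]
    exact ENNReal.toReal_pos (fermiCurveMeasure_univ_pos hμ₁ hμ₂).ne' (fermiCurveMeasure_univ_lt_top hμ₁ hμ₂).ne
  obtain ⟨im, him, him0⟩ : ∃ im : ℝ, m₀ * im = 1 ∧ 0 < im :=
    ⟨m₀⁻¹, mul_inv_cancel₀ hm₀pos.ne', inv_pos.2 hm₀pos⟩
  -- the constants of the band level
  obtain ⟨B₀, G₀, hB₀, hG₀, hest⟩ := pairingForm_one_sub_const_estimate hμ₁ hμ₂
  obtain ⟨A, hA⟩ : ∃ A : ℝ, A = 1 + |lam| * im + G₀ * im ^ 2 := ⟨_, rfl⟩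
  obtain ⟨B, hB⟩ : ∃ B : ℝ, B = B₀ * im := ⟨_, rfl⟩
  have hA1 : 1 ≤ A := by
    have : 0 ≤ |lam| * im + G₀ * im ^ 2 := by positivity
    linarith
  have hA0 : 0 ≤ A := le_trans zero_le_one hA1
  refine ⟨2 * B ^ 2 + 2 * A * (A * m₀ + B ^ 2 + m₀), by positivity, ?_⟩
  intro U hU ψ hψ
  -- the mean `a` of `ψ` and the mean-zero part `ψ - a/m₀`
  obtain ⟨a, ha⟩ : ∃ a, ∫ k, ψ k ∂fermiCurveMeasure (squareDispersion 1 0) μ = a := ⟨_, rfl⟩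
  obtain ⟨hmem', hch', hmean', hN'⟩ := a1g_sub_const hμ₁ hμ₂ hψ ha hm₀ (a * im)
  have hmean0 : ∫ k, (ψ k - a * im) ∂fermiCurveMeasure (squareDispersion 1 0) μ = 0 := by
    rw [hmean', mul_assoc, mul_comm im m₀, him, mul_one, sub_self]
  have hNval : ∫ k, (ψ k - a * im) ^ 2 ∂fermiCurveMeasure (squareDispersion 1 0) μ = 1 - a ^ 2 * im := by
    have h : (a * im) ^ 2 * m₀ = a ^ 2 * im * (m₀ * im) := by ring
    rw [hN', h, him]
    ring
  have hNnn : 0 ≤ 1 - a ^ 2 * im := by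
    rw [← hNval]; exact integral_nonneg fun k => sq_nonneg _
  have ha2im : 0 ≤ a ^ 2 * im := by positivity
  have ha2 : a ^ 2 ≤ m₀ := by
    have h1 : a ^ 2 * (m₀ * im) = a ^ 2 := by rw [him, mul_one]
    have h2 : m₀ * (a ^ 2 * im) ≤ m₀ * 1 := mul_le_mul_of_nonneg_left (by linarith) hm₀pos.le
    nlinarith [h1, h2]
  -- the three analytic inputs
  have hT : lam * (1 - a ^ 2 * im) ≤ pairingForm (squareDispersion 1 0) μ 1 (fun k => ψ k - a * im) := by
    rw [← hNval]
    exact pairingForm_one_ge_of_meanZero hμ₁ hμ₂ hlam hmem' hch' hmean0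
  have hP1 := hest ψ (a * im) hψ.1 (by rw [hNval]; linarith)
  rw [abs_mul, abs_of_pos him0] at hP1
  have hsub := kl_rl_pairingForm_sub hμ₁ hμ₂ U hψ.1
  rw [ha] at hsub
  -- the elementary cost
  have hcost := cubic_cost (B := B) hA1 (show |a| ^ 2 ≤ m₀ by rw [sq_abs]; exact ha2) hU.1
  rw [sq_abs] at hcost
  have hAexp : U ^ 2 * A * a ^ 2 = U ^ 2 * a ^ 2 + U ^ 2 * |lam| * im * a ^ 2 + U ^ 2 * G₀ * im ^ 2 * a ^ 2 := by
    rw [hA]; ring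
  have hBexp : U ^ 2 * B * |a| = U ^ 2 * B₀ * im * |a| := by
    rw [hB]; ring
  -- assemble
  have hU2 : 0 ≤ U ^ 2 := sq_nonneg U
  have h1 := mul_le_mul_of_nonneg_left hP1 hU2
  have h2 := mul_le_mul_of_nonneg_left hT hU2
  have h3 : U ^ 2 * (lam * (a ^ 2 * im)) ≤ U ^ 2 * (|lam| * (a ^ 2 * im)) :=
    mul_le_mul_of_nonneg_left (mul_le_mul_of_nonneg_right (le_abs_self lam) ha2im) hU2
  linarith [hcost, hAexp, hBexp, h1, h2, h3, hsub]

end Summit.HubbardSuperconductivity.HubbardSuperconductivity.Theorems.CwThesis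

end
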